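import Literature.NumberTheory.GaloisRepresentations.LubinTateColemanReflectionTwo
import Literature.NumberTheory.GaloisRepresentations.LubinTateColemanTraceZero
import HarnessLib

/-!
# `q = 2`: Coleman's trace operator is `(𝒮h) ∘ f = h + h(−π − X)`, and the rank-two decomposition
# `𝒪⟦X⟧ = 𝒪⟦f⟧ ⊕ X·𝒪⟦f⟧`

De Shalit, *Iwasawa theory of elliptic curves with complex multiplication* (1987), Ch. I §3.12: the trace
operator `𝒮` (`(𝒮h) ∘ f = Σ_{ω ∈ W_f^1} h(X [+] ω)`, tree `colemanTrace`) and Coleman's lemma (a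
`W_f^1`-translation-invariant series is a series in `f`).  For `f = πX + X²` over a local field `F` with
`|𝓀_F| = 2` (e.g. `F = ℚ₂`, any uniformizer `π`) everything is explicit, with `W_f^1 = {0, −π}` and the
reflection `reflTwo h = h(−π − X)` of `LubinTateColemanReflectionTwo.lean`:

* `colemanTrace_mul_subst` — for EVERY `q`: **`𝒮(k · (r ∘ f)) = (𝒮k) · r`** (series in `f` pass through `𝒮`);
* ★ `subst_colemanTrace_two` — **`(𝒮h) ∘ f = h + h(−π − X)`**; `colemanTrace_X_two` — **`𝒮 X = −π`**;
  `colemanTrace_subst_add_X_mul_subst_two` — **`𝒮(r₀ ∘ f + X·(r₁ ∘ f)) = 2r₀ − πr₁`**;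
* `exists_map_eq_of_seriesGalMap_eq` (Galois descent of series) and ★ `exists_subst_ltSer_eq_of_reflTwo_eq` /
  `existsUnique_…` / `…_iff_reflTwo_eq` — **Coleman's lemma at `q = 2`**: a series is `r ∘ f` (for a unique `r`)
  iff it is fixed by the reflection (the `f`-adic expansion `invSer` + descent to `𝒪[F]`);
* ★★ `exists_eq_subst_add_X_mul_subst_two`, `subst_add_X_mul_subst_injective_two`, `existsUnique_…` — **the
  rank-two decomposition**: every `g ∈ 𝒪[F]⟦X⟧` is uniquely `r₀ ∘ f + X·(r₁ ∘ f)` (`𝒪[F]⟦X⟧` is free of rank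
  two over `𝒪[F]⟦Y⟧`, `Y ↦ f`, basis `{1, X}`; construction: `g − g(−π − X) = πD`, `2 = πt`,
  `Q₁ = D/(1 + tX)` and `g − XQ₁` are reflection invariant); the components `evenPartTwo g = r₀`,
  `oddPartTwo g = r₁` (modulo `π`, where `f ≡ X²`, the even and odd parts of `ḡ`) with their linearity,
  `constantCoeff_evenPartTwo`, `reflTwo_eq_self_iff_oddPartTwo_eq_zero`, and
  ★★ `colemanTrace_eq_evenPartTwo_oddPartTwo` — **`𝒮g = 2·evenPartTwo g − π·oddPartTwo g`**.

0 sorry, no named facts.  The kernel and image of `𝒮` (`ker 𝒮 = (1 + (2/π)X)·𝒪⟦f⟧`, `im 𝒮 = π·𝒪⟦X⟧`) and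
Theorem I.3.7 for `ℚ₂` in power-series form follow in the sequel.

## References

* E. de Shalit, *Iwasawa theory of elliptic curves with complex multiplication* (1987), Ch. I §3.12 (Lemma,
  (22)–(23)). [deShalit1987]
* R. Coleman, *Division values in local fields*, Invent. Math. 53 (1979), Lemma 6, Thm. 4. [Coleman1979]
-/

noncomputable section

open scoped PowerSeries.WithPiTopology

namespace Literature.NumberTheory.GaloisRepresentations

section LocalFieldT2

open GaloisRepresentations.IsNonarchimedeanLocalField LubinTate ValuativeRel

variable (F : Type*) [Field F] [ValuativeRel F] [TopologicalSpace F] [IsNonarchimedeanLocalField F]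

attribute [local instance] ltNormUniformSpace ltNormIsUniformAddGroup rk1 nF nE fintypeResidueField

variable {F}
variable {π : 𝒪[F]} (hπ : (valuation F).IsUniformizer (π : F)) (n : ℕ)

/-- `f` is substitutable (`f(0) = 0`). [folklore] -/
private theorem hasSubst_ltSer₂ : PowerSeries.HasSubst (ltSer F π) :=
  PowerSeries.HasSubst.of_constantCoeff_zero' (isLTSeries_ltSer π).constantCoeff_eq_zero

include hπ in
/-- `π ≠ 0` in the coefficient ring. [folklore] -/
private theorem of_pi_ne_zero : LTCoeff.of F π ≠ 0 := fun h0 => hπ.ne_zero (by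
  have := congrArg (fun x => (((LTCoeff.of F).symm x : 𝒪[F]) : F)) h0
  simpa using this)

/-- `|𝓀_F| = 2`: a sum over `𝓀_F` has two terms. [cite: deShalit1987, Ch. I §1.7] -/
theorem sum_residueField_two (hq : residueFieldCard F = 2) {N : Type*} [AddCommMonoid N] (φ : 𝓀[F] → N) :
    ∑ c, φ c = φ 0 + φ 1 :=
  Fintype.sum_eq_add 0 1 zero_ne_one fun c hc => absurd (eq_zero_or_eq_one_two hq c) (not_or.mpr hc)

/-! ### The projection formula `𝒮(k · (r ∘ f)) = (𝒮k) · r` (any `q`) -/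

/-- ★ **`𝒮(k · (r ∘ f)) = (𝒮k) · r`**: series in `f` pass through the trace operator (`(r ∘ f)(X [+] ω) = r ∘ f`
for `ω ∈ W_f^1`), for every `q`. [cite: deShalit1987, Ch. I §3.12] -/
theorem colemanTrace_mul_subst (k r : PowerSeries (LTCoeff F)) :
    colemanTrace hπ n (k * PowerSeries.subst (ltSer F π) r) = colemanTrace hπ n k * r := by
  refine subst_injective (isLTRing_LTCoeff hπ) (isLTSeries_ltSer π) ?_
  change PowerSeries.subst (ltSer F π) (colemanTrace hπ n (k * PowerSeries.subst (ltSer F π) r)) =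
    PowerSeries.subst (ltSer F π) (colemanTrace hπ n k * r)
  refine PowerSeries.map_injective _ (algebraMap_LTCoeff_injective (ltField π n)) ?_
  rw [map_subst_colemanTrace, ← PowerSeries.coe_substAlgHom hasSubst_ltSer₂, map_mul, PowerSeries.coe_substAlgHom,
    map_mul, map_subst_colemanTrace, nSum, nSum, Finset.sum_mul]
  refine Finset.sum_congr rfl fun c _ => ?_
  rw [transl, transl, map_mul, ← transl, ← transl, transl_ltDivPt_subst_ltSer]

/-- `𝒮(r ∘ f · k) = r · 𝒮k`. [cite: deShalit1987, Ch. I §3.12] -/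
theorem colemanTrace_subst_mul (k r : PowerSeries (LTCoeff F)) :
    colemanTrace hπ n (PowerSeries.subst (ltSer F π) r * k) = r * colemanTrace hπ n k := by
  rw [mul_comm, colemanTrace_mul_subst, mul_comm]

/-! ### `q = 2`: `(𝒮h) ∘ f = h + h(−π − X)` -/

/-- ★★ **`(𝒮h) ∘ f = h + h(−π − X)` at `q = 2`** (`W_f^1 = {0, −π}`). [cite: deShalit1987, Ch. I §3.12 (23)] -/
theorem subst_colemanTrace_two (hq : residueFieldCard F = 2) (h : PowerSeries (LTCoeff F)) :
    PowerSeries.subst (ltSer F π) (colemanTrace hπ n h) = h + reflTwo hπ n h := by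
  refine PowerSeries.map_injective _ (algebraMap_LTCoeff_injective (ltField π n)) ?_
  rw [map_subst_colemanTrace, nSum, sum_residueField_two hq, map_add, transl_ltDivPt_zero, map_reflTwo hπ n hq]

/-- ★ **`𝒮 X = −π`** at `q = 2` (`X + (−π − X) = −π`). [cite: deShalit1987, Ch. I §3.12] -/
theorem colemanTrace_X_two (hq : residueFieldCard F = 2) :
    colemanTrace hπ n PowerSeries.X = -PowerSeries.C (LTCoeff.of F π) := by
  refine subst_injective (isLTRing_LTCoeff hπ) (isLTSeries_ltSer π) ?_
  change PowerSeries.subst (ltSer F π) (colemanTrace hπ n PowerSeries.X) =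
    PowerSeries.subst (ltSer F π) (-PowerSeries.C (LTCoeff.of F π))
  rw [subst_colemanTrace_two hπ n hq, reflTwo_X hπ n hq, ← PowerSeries.coe_substAlgHom hasSubst_ltSer₂, map_neg,
    PowerSeries.C_eq_algebraMap, AlgHom.commutes]
  ring

/-- ★ **`𝒮(X · (r ∘ f)) = −π · r`** at `q = 2`. [cite: deShalit1987, Ch. I §3.12] -/
theorem colemanTrace_X_mul_subst_two (hq : residueFieldCard F = 2) (r : PowerSeries (LTCoeff F)) :
    colemanTrace hπ n (PowerSeries.X * PowerSeries.subst (ltSer F π) r) = -PowerSeries.C (LTCoeff.of F π) * r := by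
  rw [colemanTrace_mul_subst, colemanTrace_X_two hπ n hq]

/-- **`𝒮(r₀ ∘ f + X · (r₁ ∘ f)) = 2 r₀ − π r₁`** at `q = 2`. [cite: deShalit1987, Ch. I §3.12] -/
theorem colemanTrace_subst_add_X_mul_subst_two (hq : residueFieldCard F = 2) (r₀ r₁ : PowerSeries (LTCoeff F)) :
    colemanTrace hπ n (PowerSeries.subst (ltSer F π) r₀ + PowerSeries.X * PowerSeries.subst (ltSer F π) r₁) =
      PowerSeries.C 2 * r₀ - PowerSeries.C (LTCoeff.of F π) * r₁ := by
  rw [colemanTrace_add, colemanTrace_X_mul_subst_two hπ n hq, ← one_mul (PowerSeries.subst (ltSer F π) r₀),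
    colemanTrace_mul_subst]
  have h1 : colemanTrace hπ n 1 = PowerSeries.C 2 := by
    refine subst_injective (isLTRing_LTCoeff hπ) (isLTSeries_ltSer π) ?_
    change PowerSeries.subst (ltSer F π) (colemanTrace hπ n 1) = PowerSeries.subst (ltSer F π) (PowerSeries.C 2)
    rw [subst_colemanTrace_two hπ n hq, ← map_one PowerSeries.C, reflTwo_C hπ n hq, ← map_add,
      ← PowerSeries.coe_substAlgHom hasSubst_ltSer₂, PowerSeries.C_eq_algebraMap, PowerSeries.C_eq_algebraMap,
      AlgHom.commutes]
    norm_num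
  rw [h1]
  ring

/-! ### Coleman's lemma at `q = 2`: reflection-invariant series are series in `f` -/

include hπ in
/-- **Galois descent of series**: a `G(K_π^{n+1}/F)`-fixed series over `𝒪_{K_π^{n+1}}` comes from `𝒪[F]⟦X⟧`.
[cite: deShalit1987, Ch. I §2.1] -/
theorem exists_map_eq_of_seriesGalMap_eq (R : PowerSeries (unitBall (ltField π n)))
    (hR : ∀ σ : ltField π n ≃ₐ[F] ltField π n, seriesGalMap σ R = R) :
    ∃ r : PowerSeries (LTCoeff F), r.map (algebraMap (LTCoeff F) (unitBall (ltField π n))) = R := by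
  haveI := isGalois_ltField hπ n
  refine ⟨PowerSeries.mk fun k => LTCoeff.of F (exists_algebraMap_eq_of_fixed (E := ltField π n)
    (s := PowerSeries.coeff k R) (fun σ => by rw [← coeff_seriesGalMap, hR])).choose, PowerSeries.ext fun k => ?_⟩
  rw [PowerSeries.coeff_map, PowerSeries.coeff_mk]
  exact (exists_algebraMap_eq_of_fixed (E := ltField π n) (s := PowerSeries.coeff k R)
    (fun σ => by rw [← coeff_seriesGalMap, hR])).choose_spec

/-- ★ **Coleman's lemma at `q = 2`**: a series `Q ∈ 𝒪[F]⟦X⟧` fixed by the reflection `X ↦ −π − X` (i.e.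
invariant under translation by `W_f^1 = {0, −π}`) is `r ∘ f` for some `r ∈ 𝒪[F]⟦X⟧` (the `f`-adic expansion,
then Galois descent). [cite: deShalit1987, Ch. I §3.12] -/
theorem exists_subst_ltSer_eq_of_reflTwo_eq (hq : residueFieldCard F = 2) {Q : PowerSeries (LTCoeff F)}
    (hQ : reflTwo hπ n Q = Q) : ∃ r : PowerSeries (LTCoeff F), PowerSeries.subst (ltSer F π) r = Q := by
  set S := unitBall (ltField π n)
  set M := maxNilIdeal F (ltField π n)
  set G := Q.map (algebraMap (LTCoeff F) S) with hG
  have hW := isColemanFamily_ltDivPt hπ n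
  -- `ι Q` is `W_f^1`-translation invariant
  have hGinv : ∀ c : 𝓀[F], evT M (tPt M (isLTRing_LTCoeff hπ) (isLTSeries_LTCoeff π) (ltDivPt hπ n c)) G = G := by
    intro c
    rcases eq_zero_or_eq_one_two hq c with rfl | rfl
    · rw [hG, evT_tPt_map_eq_transl, transl_ltDivPt_zero]
    · rw [hG, ← map_reflTwo_eq_evT hπ n hq, hQ]
  set R := invSer hW G hGinv with hR
  have hRf : PowerSeries.subst ((ltSer F π).map (algebraMap (LTCoeff F) S)) R = G := subst_invSer hW G hGinv
  -- `R` is Galois-fixed (uniqueness of the `f`-adic expansion)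
  set fS := (ltSer F π).map (algebraMap (LTCoeff F) S) with hfS
  have hfS' : IsLTSeries (algebraMap (LTCoeff F) S (LTCoeff.of F π)) (residueFieldCard F) fS :=
    (isLTSeries_ltSer π).map _
  have hπS : algebraMap (LTCoeff F) S (LTCoeff.of F π) ≠ 0 := fun h0 =>
    of_pi_ne_zero hπ (algebraMap_LTCoeff_injective (ltField π n) (by rw [h0, map_zero]))
  have hfix : ∀ σ : ltField π n ≃ₐ[F] ltField π n, seriesGalMap σ R = R := by
    intro σ
    refine subst_injective_of_isDomain hπS hfS' ?_
    change PowerSeries.subst fS (seriesGalMap σ R) = PowerSeries.subst fS R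
    have hσf : PowerSeries.map (toUnitBallHom σ : S →+* S) fS = fS := by
      rw [← seriesGalMap_apply, hfS, seriesGalMap_map]
    have e : PowerSeries.map (toUnitBallHom σ : S →+* S) (PowerSeries.subst fS R) =
        PowerSeries.subst (PowerSeries.map (toUnitBallHom σ : S →+* S) fS)
          (PowerSeries.map (toUnitBallHom σ : S →+* S) R) :=
      PowerSeries.map_subst (PowerSeries.HasSubst.of_constantCoeff_zero' hfS'.constantCoeff_eq_zero) _
    rw [hσf, ← seriesGalMap_apply, ← seriesGalMap_apply, hRf, hG, seriesGalMap_map] at e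
    rw [← e, hRf]
  obtain ⟨r, hr⟩ := exists_map_eq_of_seriesGalMap_eq hπ n R hfix
  refine ⟨r, PowerSeries.map_injective _ (algebraMap_LTCoeff_injective (ltField π n)) ?_⟩
  have e : PowerSeries.map (algebraMap (LTCoeff F) S) (PowerSeries.subst (ltSer F π) r) =
      PowerSeries.subst fS (r.map (algebraMap (LTCoeff F) S)) := PowerSeries.map_subst hasSubst_ltSer₂ _
  rw [e, hr, hRf]

/-- … and that `r` is unique (`r ↦ r ∘ f` is injective). [cite: deShalit1987, Ch. I §3.12] -/
theorem existsUnique_subst_ltSer_eq_of_reflTwo_eq (hq : residueFieldCard F = 2) {Q : PowerSeries (LTCoeff F)}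
    (hQ : reflTwo hπ n Q = Q) : ∃! r : PowerSeries (LTCoeff F), PowerSeries.subst (ltSer F π) r = Q := by
  obtain ⟨r, hr⟩ := exists_subst_ltSer_eq_of_reflTwo_eq hπ n hq hQ
  exact ⟨r, hr, fun r' hr' => subst_injective (isLTRing_LTCoeff hπ) (isLTSeries_ltSer π) (hr'.trans hr.symm)⟩

/-- `Q` is `r ∘ f` for some `r` iff `Q` is reflection-invariant. [cite: deShalit1987, Ch. I §3.12] -/
theorem exists_subst_ltSer_eq_iff_reflTwo_eq (hq : residueFieldCard F = 2) (Q : PowerSeries (LTCoeff F)) :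
    (∃ r : PowerSeries (LTCoeff F), PowerSeries.subst (ltSer F π) r = Q) ↔ reflTwo hπ n Q = Q :=
  ⟨fun ⟨r, hr⟩ => by rw [← hr, reflTwo_subst_ltSer hπ n hq], exists_subst_ltSer_eq_of_reflTwo_eq hπ n hq⟩

/-! ### The rank-two decomposition `𝒪⟦X⟧ = 𝒪⟦f⟧ ⊕ X · 𝒪⟦f⟧` -/

/-- `reflTwo (C π + 2X) = −(C π + 2X)`: the different `f'(X) = 2X + π` is reflection-ANTI-invariant.
[cite: deShalit1987, Ch. I §3.12] -/
theorem reflTwo_C_add_two_mul_X (hq : residueFieldCard F = 2) :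
    reflTwo hπ n (PowerSeries.C (LTCoeff.of F π) + 2 * PowerSeries.X) =
      -(PowerSeries.C (LTCoeff.of F π) + 2 * PowerSeries.X) := by
  rw [reflTwo_add hπ n hq, reflTwo_C hπ n hq, show (2 : PowerSeries (LTCoeff F)) = PowerSeries.C 2 by
    rw [map_ofNat], reflTwo_C_mul hπ n hq, reflTwo_X hπ n hq, map_ofNat]
  ring

include hπ in
/-- `C π + 2X ≠ 0`. [cite: deShalit1987, Ch. I §3.12] -/
private theorem C_add_two_mul_X_ne_zero : PowerSeries.C (LTCoeff.of F π) + 2 * PowerSeries.X ≠ (0 : PowerSeries (LTCoeff F)) := by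
  intro h0
  have h1 := congrArg PowerSeries.constantCoeff h0
  rw [map_add, map_mul, PowerSeries.constantCoeff_C, PowerSeries.constantCoeff_X, mul_zero, add_zero, map_zero] at h1
  exact of_pi_ne_zero hπ h1

include hπ in
/-- **Uniqueness of the decomposition**: `r₀ ∘ f + X · (r₁ ∘ f) = r₀' ∘ f + X · (r₁' ∘ f) ⟹ r₀ = r₀' ∧ r₁ = r₁'`
(apply the reflection and subtract: `(2X + π) · ((r₁ − r₁') ∘ f) = 0` in the domain `𝒪[F]⟦X⟧`).
[cite: deShalit1987, Ch. I §3.12] -/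
theorem subst_add_X_mul_subst_injective_two (hq : residueFieldCard F = 2) {r₀ r₁ r₀' r₁' : PowerSeries (LTCoeff F)}
    (h : PowerSeries.subst (ltSer F π) r₀ + PowerSeries.X * PowerSeries.subst (ltSer F π) r₁ =
      PowerSeries.subst (ltSer F π) r₀' + PowerSeries.X * PowerSeries.subst (ltSer F π) r₁') :
    r₀ = r₀' ∧ r₁ = r₁' := by
  haveI : IsDomain (LTCoeff F) := inferInstanceAs (IsDomain 𝒪[F])
  have h' := congrArg (reflTwo hπ 0) h
  rw [reflTwo_add hπ 0 hq, reflTwo_add hπ 0 hq, reflTwo_mul hπ 0 hq, reflTwo_mul hπ 0 hq, reflTwo_X hπ 0 hq,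
    reflTwo_subst_ltSer hπ 0 hq, reflTwo_subst_ltSer hπ 0 hq, reflTwo_subst_ltSer hπ 0 hq,
    reflTwo_subst_ltSer hπ 0 hq] at h'
  have h1 : (PowerSeries.C (LTCoeff.of F π) + 2 * PowerSeries.X) *
      (PowerSeries.subst (ltSer F π) r₁ - PowerSeries.subst (ltSer F π) r₁') = 0 := by
    linear_combination h - h'
  rcases mul_eq_zero.mp h1 with h2 | h2
  · exact absurd h2 (C_add_two_mul_X_ne_zero hπ)
  · have hr₁ : r₁ = r₁' := subst_injective (isLTRing_LTCoeff hπ) (isLTSeries_ltSer π) (sub_eq_zero.mp h2)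
    subst hr₁
    exact ⟨subst_injective (isLTRing_LTCoeff hπ) (isLTSeries_ltSer π) (add_right_cancel h), rfl⟩

include hπ in
/-- ★★ **The rank-two decomposition at `q = 2`**: every `g ∈ 𝒪[F]⟦X⟧` is `r₀ ∘ f + X · (r₁ ∘ f)` —
`𝒪[F]⟦X⟧` is free of rank two over `𝒪[F]⟦Y⟧` (acting through `Y ↦ f`) on the basis `{1, X}`.  Construction:
`g − g(−π − X) = π D` (`sub_reflTwo_mem_coeffIdeal`), `2 = π t` (`|𝓀_F| = 2`), `Q₁ := D · (1 + tX)⁻¹` and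
`g − X Q₁` are reflection-invariant, hence series in `f` (Coleman's lemma). [cite: deShalit1987, Ch. I §3.12] -/
theorem exists_eq_subst_add_X_mul_subst_two (hq : residueFieldCard F = 2) (g : PowerSeries (LTCoeff F)) :
    ∃ r₀ r₁ : PowerSeries (LTCoeff F),
      g = PowerSeries.subst (ltSer F π) r₀ + PowerSeries.X * PowerSeries.subst (ltSer F π) r₁ := by
  haveI : IsDomain (LTCoeff F) := inferInstanceAs (IsDomain 𝒪[F])
  obtain ⟨t, ht⟩ := exists_two_eq_pi_mul hπ hq
  obtain ⟨D, hD⟩ := exists_eq_C_mul_of_mem_coeffIdeal_span (sub_reflTwo_mem_coeffIdeal hπ 0 hq g)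
  -- the unit `w = 1 + tX` with `C π · w = C π + 2X`
  set w : PowerSeries (LTCoeff F) := 1 + PowerSeries.C t * PowerSeries.X with hw
  have hwu : IsUnit w := by
    rw [PowerSeries.isUnit_iff_constantCoeff, hw, map_add, map_one, map_mul, PowerSeries.constantCoeff_X, mul_zero,
      add_zero]
    exact isUnit_one
  have hπw : PowerSeries.C (LTCoeff.of F π) * w = PowerSeries.C (LTCoeff.of F π) + 2 * PowerSeries.X := by
    rw [hw, mul_add, mul_one, ← mul_assoc, ← map_mul, ← ht, map_ofNat]
  set Q₁ : PowerSeries (LTCoeff F) := D * ↑hwu.unit⁻¹ with hQ₁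
  have hQ₁e : (PowerSeries.C (LTCoeff.of F π) + 2 * PowerSeries.X) * Q₁ = g - reflTwo hπ 0 g := by
    rw [← hπw, hQ₁, mul_assoc, mul_left_comm w, IsUnit.mul_val_inv, mul_one, hD]
  -- `Q₁` is reflection-invariant
  have hQ₁r : reflTwo hπ 0 Q₁ = Q₁ := by
    have h1 := congrArg (reflTwo hπ 0) hQ₁e
    rw [reflTwo_mul hπ 0 hq, reflTwo_C_add_two_mul_X hπ 0 hq, reflTwo_sub hπ 0 hq, reflTwo_reflTwo hπ 0 hq] at h1
    have h2 : (PowerSeries.C (LTCoeff.of F π) + 2 * PowerSeries.X) * (reflTwo hπ 0 Q₁ - Q₁) = 0 := by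
      linear_combination -hQ₁e - h1
    rcases mul_eq_zero.mp h2 with h3 | h3
    · exact absurd h3 (C_add_two_mul_X_ne_zero hπ)
    · exact sub_eq_zero.mp h3
  obtain ⟨r₁, hr₁⟩ := exists_subst_ltSer_eq_of_reflTwo_eq hπ 0 hq hQ₁r
  -- `g − X Q₁` is reflection-invariant
  have hR₀r : reflTwo hπ 0 (g - PowerSeries.X * Q₁) = g - PowerSeries.X * Q₁ := by
    rw [reflTwo_sub hπ 0 hq, reflTwo_mul hπ 0 hq, reflTwo_X hπ 0 hq, hQ₁r]
    linear_combination hQ₁e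
  obtain ⟨r₀, hr₀⟩ := exists_subst_ltSer_eq_of_reflTwo_eq hπ 0 hq hR₀r
  exact ⟨r₀, r₁, by rw [hr₀, hr₁]; ring⟩

include hπ in
/-- ★★ **… uniquely**: the pair `(r₀, r₁)`. [cite: deShalit1987, Ch. I §3.12] -/
theorem existsUnique_eq_subst_add_X_mul_subst_two (hq : residueFieldCard F = 2) (g : PowerSeries (LTCoeff F)) :
    ∃! r : PowerSeries (LTCoeff F) × PowerSeries (LTCoeff F),
      g = PowerSeries.subst (ltSer F π) r.1 + PowerSeries.X * PowerSeries.subst (ltSer F π) r.2 := by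
  obtain ⟨r₀, r₁, h⟩ := exists_eq_subst_add_X_mul_subst_two hπ hq g
  refine ⟨(r₀, r₁), h, fun r' h' => ?_⟩
  obtain ⟨h0, h1⟩ := subst_add_X_mul_subst_injective_two hπ hq (h'.symm.trans h)
  exact Prod.ext h0 h1

/-! ### The two components `r₀ = evenPartTwo g`, `r₁ = oddPartTwo g` -/

include hπ in
/-- **`evenPartTwo g = r₀`**, the first component of `g = r₀ ∘ f + X·(r₁ ∘ f)` (`q = 2`; modulo `π`, where
`f ≡ X²`, it is the even part of `ḡ`). [cite: deShalit1987, Ch. I §3.12] -/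
def evenPartTwo (hq : residueFieldCard F = 2) (g : PowerSeries (LTCoeff F)) : PowerSeries (LTCoeff F) :=
  (exists_eq_subst_add_X_mul_subst_two hπ hq g).choose

include hπ in
/-- **`oddPartTwo g = r₁`**, the second component of `g = r₀ ∘ f + X·(r₁ ∘ f)` (`q = 2`).
[cite: deShalit1987, Ch. I §3.12] -/
def oddPartTwo (hq : residueFieldCard F = 2) (g : PowerSeries (LTCoeff F)) : PowerSeries (LTCoeff F) :=
  (exists_eq_subst_add_X_mul_subst_two hπ hq g).choose_spec.choose

include hπ in
/-- ★ `g = (evenPartTwo g) ∘ f + X · ((oddPartTwo g) ∘ f)`. [cite: deShalit1987, Ch. I §3.12] -/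
theorem eq_evenPartTwo_add_X_mul_oddPartTwo (hq : residueFieldCard F = 2) (g : PowerSeries (LTCoeff F)) :
    g = PowerSeries.subst (ltSer F π) (evenPartTwo hπ hq g) +
      PowerSeries.X * PowerSeries.subst (ltSer F π) (oddPartTwo hπ hq g) :=
  (exists_eq_subst_add_X_mul_subst_two hπ hq g).choose_spec.choose_spec

include hπ in
/-- The components of `r₀ ∘ f + X·(r₁ ∘ f)` are `r₀`, `r₁`. [cite: deShalit1987, Ch. I §3.12] -/
theorem evenPartTwo_oddPartTwo_eq (hq : residueFieldCard F = 2) (r₀ r₁ : PowerSeries (LTCoeff F)) :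
    evenPartTwo hπ hq (PowerSeries.subst (ltSer F π) r₀ + PowerSeries.X * PowerSeries.subst (ltSer F π) r₁) = r₀ ∧
      oddPartTwo hπ hq (PowerSeries.subst (ltSer F π) r₀ + PowerSeries.X * PowerSeries.subst (ltSer F π) r₁) = r₁ :=
  subst_add_X_mul_subst_injective_two hπ hq (eq_evenPartTwo_add_X_mul_oddPartTwo hπ hq _).symm

include hπ in
/-- `evenPartTwo (r ∘ f) = r`, `oddPartTwo (r ∘ f) = 0`. [cite: deShalit1987, Ch. I §3.12] -/
theorem evenPartTwo_oddPartTwo_subst (hq : residueFieldCard F = 2) (r : PowerSeries (LTCoeff F)) :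
    evenPartTwo hπ hq (PowerSeries.subst (ltSer F π) r) = r ∧ oddPartTwo hπ hq (PowerSeries.subst (ltSer F π) r) = 0 := by
  have h := evenPartTwo_oddPartTwo_eq hπ hq r 0
  rwa [← PowerSeries.coe_substAlgHom hasSubst_ltSer₂, map_zero, mul_zero, add_zero, PowerSeries.coe_substAlgHom] at h

include hπ in
/-- `evenPartTwo (X · (r ∘ f)) = 0`, `oddPartTwo (X · (r ∘ f)) = r`. [cite: deShalit1987, Ch. I §3.12] -/
theorem evenPartTwo_oddPartTwo_X_mul_subst (hq : residueFieldCard F = 2) (r : PowerSeries (LTCoeff F)) :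
    evenPartTwo hπ hq (PowerSeries.X * PowerSeries.subst (ltSer F π) r) = 0 ∧
      oddPartTwo hπ hq (PowerSeries.X * PowerSeries.subst (ltSer F π) r) = r := by
  have h := evenPartTwo_oddPartTwo_eq hπ hq 0 r
  rwa [← PowerSeries.coe_substAlgHom hasSubst_ltSer₂, map_zero, zero_add, PowerSeries.coe_substAlgHom] at h

include hπ in
/-- The components are additive. [cite: deShalit1987, Ch. I §3.12] -/
theorem evenPartTwo_oddPartTwo_add (hq : residueFieldCard F = 2) (g g' : PowerSeries (LTCoeff F)) :
    evenPartTwo hπ hq (g + g') = evenPartTwo hπ hq g + evenPartTwo hπ hq g' ∧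
      oddPartTwo hπ hq (g + g') = oddPartTwo hπ hq g + oddPartTwo hπ hq g' := by
  refine subst_add_X_mul_subst_injective_two hπ hq ?_
  rw [← eq_evenPartTwo_add_X_mul_oddPartTwo hπ hq (g + g'), PowerSeries.subst_add hasSubst_ltSer₂,
    PowerSeries.subst_add hasSubst_ltSer₂]
  conv_lhs => rw [eq_evenPartTwo_add_X_mul_oddPartTwo hπ hq g, eq_evenPartTwo_add_X_mul_oddPartTwo hπ hq g']
  ring

include hπ in
/-- The components are `𝒪[F]`-linear. [cite: deShalit1987, Ch. I §3.12] -/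
theorem evenPartTwo_oddPartTwo_C_mul (hq : residueFieldCard F = 2) (a : LTCoeff F) (g : PowerSeries (LTCoeff F)) :
    evenPartTwo hπ hq (PowerSeries.C a * g) = PowerSeries.C a * evenPartTwo hπ hq g ∧
      oddPartTwo hπ hq (PowerSeries.C a * g) = PowerSeries.C a * oddPartTwo hπ hq g := by
  refine subst_add_X_mul_subst_injective_two hπ hq ?_
  rw [← eq_evenPartTwo_add_X_mul_oddPartTwo hπ hq (PowerSeries.C a * g), subst_C_mul (isLTSeries_ltSer π),
    subst_C_mul (isLTSeries_ltSer π)]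
  conv_lhs => rw [eq_evenPartTwo_add_X_mul_oddPartTwo hπ hq g]
  ring

include hπ in
/-- `(evenPartTwo g)(0) = g(0)` (`f(0) = 0`). [cite: deShalit1987, Ch. I §3.12] -/
theorem constantCoeff_evenPartTwo (hq : residueFieldCard F = 2) (g : PowerSeries (LTCoeff F)) :
    PowerSeries.constantCoeff (evenPartTwo hπ hq g) = PowerSeries.constantCoeff g := by
  conv_rhs => rw [eq_evenPartTwo_add_X_mul_oddPartTwo hπ hq g]
  rw [map_add, map_mul, PowerSeries.constantCoeff_X, zero_mul, add_zero, constantCoeff_subst_ltSer]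

include hπ in
/-- `g` is reflection invariant iff its odd part vanishes. [cite: deShalit1987, Ch. I §3.12] -/
theorem reflTwo_eq_self_iff_oddPartTwo_eq_zero (hq : residueFieldCard F = 2) (g : PowerSeries (LTCoeff F)) :
    reflTwo hπ 0 g = g ↔ oddPartTwo hπ hq g = 0 := by
  constructor
  · intro h
    obtain ⟨r, hr⟩ := exists_subst_ltSer_eq_of_reflTwo_eq hπ 0 hq h
    rw [← hr]
    exact (evenPartTwo_oddPartTwo_subst hπ hq r).2
  · intro h
    rw [eq_evenPartTwo_add_X_mul_oddPartTwo hπ hq g, h, ← PowerSeries.coe_substAlgHom hasSubst_ltSer₂, map_zero,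
      mul_zero, add_zero, PowerSeries.coe_substAlgHom, reflTwo_subst_ltSer hπ 0 hq]

/-- ★★ **`𝒮g = 2·evenPartTwo g − π·oddPartTwo g`** at `q = 2`. [cite: deShalit1987, Ch. I §3.12] -/
theorem colemanTrace_eq_evenPartTwo_oddPartTwo (hq : residueFieldCard F = 2) (g : PowerSeries (LTCoeff F)) :
    colemanTrace hπ n g = PowerSeries.C 2 * evenPartTwo hπ hq g - PowerSeries.C (LTCoeff.of F π) * oddPartTwo hπ hq g := by
  conv_lhs => rw [eq_evenPartTwo_add_X_mul_oddPartTwo hπ hq g]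
  exact colemanTrace_subst_add_X_mul_subst_two hπ n hq _ _

end LocalFieldT2

end Literature.NumberTheory.GaloisRepresentations
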